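import Summits.ResolutionOfSingularities.ResolutionOfSingularities.Theorems.EquisingularLiftEquisingularLiftNatClusterPointDict
import Summits.ResolutionOfSingularities.ResolutionOfSingularities.Theorems.EquisingularLiftEquisingularLiftNatCarrierDeltaOffVertex
import HarnessLib

/-!
# [OURS · L1 W4.5(b) · EL♮(3)] (δ) D3 POINT-DICT, part 2a: CHART CHANGE of a coordinate point of the exceptional divisor

Crux chain w45b (cell `res-hironaka`, slot W4.5(b)), working crux **EL♮** = stmt-ResolutionOfSingularities-20038, child **EL♮(3)** =
stmt-ResolutionOfSingularities-20148, route EquisingularLift, line `sections`, registered stub `stub_elnat_tcPlusPlusPointResolution`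
(v2); brick **(δ) D3 POINT-DICT** (res-L1-w45b-stub-3 `DELTA-PLAN.md`; res-L1-w45b-plan-1 DE-COLLISION 2026-08-27T17:03:18Z: D3 whole
:= res-type-100). HONEST FRAMING: OURS; NOT a statement of any manuscript; AI-written, weaker than expert review. No `sorry`; standard
axioms. DEF-FREE. `--supports stmt-ResolutionOfSingularities-20148 --as helper`.

WHY. A cluster point `y′_t` is presented on its own chart `i t` (part 1), but the COVER clause of `FatCluster` finds a non-regular point of the
reduced carrier curve on whatever chart `jj` it was read; part 2b (…NatClusterPointCover) needs to move a coordinate point between charts.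

WHAT (namespace `…Cruxes.EquisingularLiftNat.Sections`).
* `isUnit_of_sub_mem_maximalIdeal` — in a local ring an element congruent to a unit modulo `𝔪` is a unit.
* `frac_sub_mem_of_chartChange` (ring form) — `φ : R → S` local ring of a point over the centre `(c)`, `φ(c_jj)` a non-zero-divisor; chart
  maps `χ : R[I/c_jj] → S`, `χ′ : R[I/c_m] → S` over `φ` with `𝔔 = χ⁻¹𝔪_S`, `𝔔′ = χ′⁻¹𝔪_S`; chart-`jj` coordinates `b` (`c_l/c_jj − b_l ∈ 𝔔`)
  with `b_m` a unit ⟹ chart-`m` coordinates `b_l/b_m` (`b_jj := 1`): `c_l/c_m − b_l b_m⁻¹ ∈ 𝔔′` (cancel `φ(c_jj)` in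
  `χ′(c_l/c_m)·χ(c_m/c_jj)·φ(c_jj) = φ(c_l) = χ(c_l/c_jj)·φ(c_jj)`).
* `stalkCongr_inv_comp_apply_eq` — the two `stalkCongr` spellings of `υ♯_w` read at `x = υ w` agree.
* `exists_chartPresentation_of_isUnit_coord` — a coordinate point with `b_m` a unit is VISIBLE on the chart `m` (`υ♯ c̄_m` generates the
  exceptional stalk; res-D-pv-029's prescribed-chart presentation B1★ p537631 via res-L1-w45b-stub-2's `exists_prescribedChartPresentation_of_eq`).
* **`forall_frac_sub_mem_of_chartChange`** (scheme form) — on ANY chart-`m` presentation of such a point the coordinates are `b_l/b_m`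
  (`υ♯ c̄_jj` is a non-zero-divisor: effective Cartier exceptional divisor).

References: res-L1-w45b-stub-2 …NatBlowupChartPointInjective (p540294), …NatCarrierDeltaOffVertex; res-D-pv-029 …NatBlowupStalkPrescribedChart
(p537631); The Stacks Project, Tag 0804 [cite: StacksProject, Tag 0804].
-/

set_option linter.dupNamespace false -- mandated namespace `Summit.<Summit>.<Problem>` of this single-conjunct summit

noncomputable section

open CategoryTheory CategoryTheory.Limits AlgebraicGeometry TopologicalSpace IsLocalRing
open Literature.AlgebraicGeometry.Resolution
open AlgebraicGeometry.Scheme.IdealSheafData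

namespace Summit.ResolutionOfSingularities.ResolutionOfSingularities.Cruxes.EquisingularLiftNat.Sections

universe u

/-! ## 1. Chart change of a coordinate point -/

section ChartChangeRing

variable {R S : Type u} [CommRing R] [CommRing S] [IsLocalRing S] {k : ℕ} (c : Fin k → R) (jj m : Fin k)

/-- In a local ring, an element congruent to a unit modulo the maximal ideal is a unit. [folklore] -/
theorem isUnit_of_sub_mem_maximalIdeal {u v : S} (hv : IsUnit v) (h : u - v ∈ maximalIdeal S) : IsUnit u := by
  by_contra hu
  have hu' : u ∈ maximalIdeal S := (mem_maximalIdeal _).mpr hu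
  have hv' : v ∈ maximalIdeal S := by
    have := (maximalIdeal S).sub_mem hu' h
    rwa [sub_sub_cancel] at this
  exact (mem_maximalIdeal _).mp hv' hv

/-- **Chart change of a coordinate point (ring form).** `φ : R → S` (the structure map of the local ring `S` of a point over the
centre `(c)`), `φ(c_jj)` a non-zero-divisor of `S`; `χ : R[I/c_jj] → S`, `χ′ : R[I/c_m] → S` two chart maps over `φ` with `𝔔 = χ⁻¹𝔪_S`,
`𝔔′ = χ′⁻¹𝔪_S`; chart-`jj` coordinates `b` (`c_l/c_jj − b_l ∈ 𝔔`) with `b_m` a unit (`m ≠ jj`). Then on the chart `m` the coordinates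
are `b_l/b_m` (`b_jj := 1`): `c_l/c_m − b_l b_m⁻¹ ∈ 𝔔′` — from `χ′(c_l/c_m)·χ(c_m/c_jj)·φ(c_jj) = φ(c_l) = χ(c_l/c_jj)·φ(c_jj)` and the
cancellation of `φ(c_jj)`. [cite: StacksProject, Tag 0804] -/
theorem frac_sub_mem_of_chartChange (hm : m ≠ jj) (φ : R →+* S) (hnzd : φ (c jj) ∈ nonZeroDivisors S)
    (𝔔 : Ideal (blowupAlgebra (Ideal.span (Set.range c)) (c jj)))
    (χ : blowupAlgebra (Ideal.span (Set.range c)) (c jj) →+* S) (hχ : ∀ r, χ (algebraMap R _ r) = φ r)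
    (h𝔔χ : ∀ b', b' ∈ 𝔔 ↔ χ b' ∈ maximalIdeal S)
    (𝔔' : Ideal (blowupAlgebra (Ideal.span (Set.range c)) (c m)))
    (χ' : blowupAlgebra (Ideal.span (Set.range c)) (c m) →+* S) (hχ' : ∀ r, χ' (algebraMap R _ r) = φ r)
    (h𝔔χ' : ∀ b', b' ∈ 𝔔' ↔ χ' b' ∈ maximalIdeal S)
    (b : {l : Fin k // l ≠ jj} → R)
    (hfr : ∀ l : {l : Fin k // l ≠ jj}, blowupAlgebra.frac c jj l.1 - algebraMap R _ (b l) ∈ 𝔔)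
    (hbm : IsUnit (b ⟨m, hm⟩)) (l : {l : Fin k // l ≠ m}) :
    blowupAlgebra.frac c m l.1 -
      algebraMap R _ ((if h : l.1 = jj then (1 : R) else b ⟨l.1, h⟩) * ↑hbm.unit⁻¹) ∈ 𝔔' := by
  classical
  -- `χ (c_l/c_jj) ≡ φ (B l)` for the extended coordinate vector `B`, `B jj = 1`
  have hcong : ∀ l' : Fin k,
      χ (blowupAlgebra.frac c jj l') - φ (if h : l' = jj then (1 : R) else b ⟨l', h⟩) ∈ maximalIdeal S := by
    intro l'
    by_cases h : l' = jj
    · subst h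
      have h1 : blowupAlgebra.frac c l' l' = 1 := blowupAlgebra.gen_self _ _ _
      rw [h1, map_one, dif_pos rfl, map_one, sub_self]
      exact zero_mem _
    · have := (h𝔔χ _).mp (hfr ⟨l', h⟩)
      rw [map_sub, hχ] at this
      rw [dif_neg h]
      exact this
  have hcongm : χ (blowupAlgebra.frac c jj m) - φ (b ⟨m, hm⟩) ∈ maximalIdeal S := by
    have := hcong m
    rwa [dif_neg hm] at this
  -- the chart relations and the unit `u = χ (c_m/c_jj)`
  have hrel : ∀ l', χ (blowupAlgebra.frac c jj l') * φ (c jj) = φ (c l') := fun l' => apply_frac_mul c jj l' χ φ hχ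
  have hrel' : ∀ l', χ' (blowupAlgebra.frac c m l') * φ (c m) = φ (c l') := fun l' => apply_frac_mul c m l' χ' φ hχ'
  have hu : IsUnit (χ (blowupAlgebra.frac c jj m)) := isUnit_of_sub_mem_maximalIdeal (hbm.map φ) hcongm
  have hkey : ∀ l' : Fin k,
      χ' (blowupAlgebra.frac c m l') * χ (blowupAlgebra.frac c jj m) = χ (blowupAlgebra.frac c jj l') := by
    intro l'
    apply (mul_cancel_right_mem_nonZeroDivisors hnzd).mp
    rw [mul_assoc, hrel m, hrel' l', hrel l']
  -- read the goal in `S`, multiply by the unit `u`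
  rw [h𝔔χ', map_sub, hχ']
  have hval : φ ((if h : l.1 = jj then (1 : R) else b ⟨l.1, h⟩) * ↑hbm.unit⁻¹) * φ (b ⟨m, hm⟩) =
      φ (if h : l.1 = jj then (1 : R) else b ⟨l.1, h⟩) := by
    rw [← map_mul, mul_assoc, IsUnit.val_inv_mul, mul_one]
  have hmul : (χ' (blowupAlgebra.frac c m l.1) -
      φ ((if h : l.1 = jj then (1 : R) else b ⟨l.1, h⟩) * ↑hbm.unit⁻¹)) * χ (blowupAlgebra.frac c jj m) =
      (χ (blowupAlgebra.frac c jj l.1) - φ (if h : l.1 = jj then (1 : R) else b ⟨l.1, h⟩)) -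
        φ ((if h : l.1 = jj then (1 : R) else b ⟨l.1, h⟩) * ↑hbm.unit⁻¹) *
          (χ (blowupAlgebra.frac c jj m) - φ (b ⟨m, hm⟩)) := by
    rw [sub_mul, hkey, mul_sub, hval]; ring
  have hmem : (χ' (blowupAlgebra.frac c m l.1) -
      φ ((if h : l.1 = jj then (1 : R) else b ⟨l.1, h⟩) * ↑hbm.unit⁻¹)) * χ (blowupAlgebra.frac c jj m) ∈
      maximalIdeal S := by
    rw [hmul]
    exact (maximalIdeal S).sub_mem (hcong l.1) (Ideal.mul_mem_left _ _ hcongm)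
  have := Ideal.mul_mem_right (↑hu.unit⁻¹ : S) _ hmem
  rwa [mul_assoc, IsUnit.mul_val_inv, mul_one] at this

end ChartChangeRing

section ChartChangeScheme

variable {F₁ F₂ : Scheme.{u}} {υ : F₂ ⟶ F₁} {J : F₁.IdealSheafData}

/-- `((stalkCongr h)⁻¹ ≫ υ♯_w)(r)` in the `stalkCongr h.symm` spelling of res-L1-w45b-stub-2's chart lemmas. [folklore] -/
theorem stalkCongr_inv_comp_apply_eq {w : F₂} {x : F₁} (hw : υ w = x) (r : F₁.presheaf.stalk x) :
    ((F₁.presheaf.stalkCongr (.of_eq hw)).inv ≫ υ.stalkMap w).hom r =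
      (υ.stalkMap w).hom ((F₁.presheaf.stalkCongr (.of_eq hw.symm)).hom r) := by
  subst hw
  simp only [CommRingCat.comp_apply, TopCat.Presheaf.stalkCongr_inv, TopCat.Presheaf.stalkCongr_hom,
    stalkSpecializes_self_apply]

/-- **A coordinate point with a unit coordinate `b_m` is visible on the chart `m`**: if `w` over `x` has chart-`jj` coordinates `b`
with `b_m` a unit, then `υ♯(c̄_m)` generates the exceptional stalk at `w` and `𝒪_{F₂,w}` has a presentation on the chart `c̄_m` (res-D-pv-029's
prescribed-chart presentation B1★). [cite: StacksProject, Tag 0804] -/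
theorem exists_chartPresentation_of_isUnit_coord (hυ : IsBlowup υ J) {w : F₂} {x : F₁} (hw : υ w = x) {k : ℕ}
    (c : Fin k → F₁.presheaf.stalk x) (hcJ : Ideal.span (Set.range c) = stalkIdeal J x) (jj m : Fin k) (hm : m ≠ jj)
    (𝔔 : PrimeSpectrum (blowupAlgebra (Ideal.span (Set.range c)) (c jj)))
    (χ : blowupAlgebra (Ideal.span (Set.range c)) (c jj) →+* F₂.presheaf.stalk w)
    (hχ : ∀ r, χ (algebraMap _ _ r) = ((F₁.presheaf.stalkCongr (.of_eq hw)).inv ≫ υ.stalkMap w).hom r)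
    (hloc : @IsLocalization.AtPrime _ _ (F₂.presheaf.stalk w) _ χ.toAlgebra 𝔔.asIdeal _)
    (b : {l : Fin k // l ≠ jj} → F₁.presheaf.stalk x)
    (hfr : ∀ l : {l : Fin k // l ≠ jj}, blowupAlgebra.frac c jj l.1 - algebraMap _ _ (b l) ∈ 𝔔.asIdeal)
    (hbm : IsUnit (b ⟨m, hm⟩)) :
    ∃ (𝔔' : PrimeSpectrum (blowupAlgebra (Ideal.span (Set.range c)) (c m)))
      (χ' : blowupAlgebra (Ideal.span (Set.range c)) (c m) →+* F₂.presheaf.stalk w),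
      (∀ r, χ' (algebraMap _ _ r) = ((F₁.presheaf.stalkCongr (.of_eq hw)).inv ≫ υ.stalkMap w).hom r) ∧
      @IsLocalization.AtPrime _ _ (F₂.presheaf.stalk w) _ χ'.toAlgebra 𝔔'.asIdeal _ ∧
      𝔔'.asIdeal.comap (algebraMap _ (blowupAlgebra (Ideal.span (Set.range c)) (c m))) =
        maximalIdeal (F₁.presheaf.stalk x) := by
  have h𝔔χ : ∀ b', b' ∈ 𝔔.asIdeal ↔ χ b' ∈ maximalIdeal (F₂.presheaf.stalk w) :=
    fun b' => mem_chartPrime_iff_apply_mem_maximalIdeal 𝔔 χ hloc b'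
  have hcongm : χ (blowupAlgebra.frac c jj m) -
      ((F₁.presheaf.stalkCongr (.of_eq hw)).inv ≫ υ.stalkMap w).hom (b ⟨m, hm⟩) ∈ maximalIdeal (F₂.presheaf.stalk w) := by
    have := (h𝔔χ _).mp (hfr ⟨m, hm⟩)
    rwa [map_sub, hχ] at this
  have hu : IsUnit (χ (blowupAlgebra.frac c jj m)) :=
    isUnit_of_sub_mem_maximalIdeal (hbm.map ((F₁.presheaf.stalkCongr (.of_eq hw)).inv ≫ υ.stalkMap w).hom) hcongm
  have hEjj := stalkIdeal_comap_eq_span_of_chartPresentation w hw c hcJ jj χ hχ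
  have hEm := stalkIdeal_comap_eq_span_of_isUnit_frac w hw c jj m χ hχ hEjj hu
  obtain ⟨𝔔', χ', hχ', hloc', h𝔔'⟩ := exists_prescribedChartPresentation_of_eq hυ w hw c hcJ m hEm
  exact ⟨𝔔', χ', hχ', hloc', h𝔔'⟩

/-- **Chart change of a coordinate point (scheme form).** For `w` over `x` with chart-`jj` coordinates `b`, `b_m` a unit, and ANY
presentation of `𝒪_{F₂,w}` on the chart `c̄_m`: the chart-`m` coordinates of `w` are `b_l/b_m` (`b_jj := 1`).
[cite: StacksProject, Tag 0804] -/
theorem forall_frac_sub_mem_of_chartChange (hυ : IsBlowup υ J) {w : F₂} {x : F₁} (hw : υ w = x) {k : ℕ}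
    (c : Fin k → F₁.presheaf.stalk x) (hcJ : Ideal.span (Set.range c) = stalkIdeal J x) (jj m : Fin k) (hm : m ≠ jj)
    (𝔔 : PrimeSpectrum (blowupAlgebra (Ideal.span (Set.range c)) (c jj)))
    (χ : blowupAlgebra (Ideal.span (Set.range c)) (c jj) →+* F₂.presheaf.stalk w)
    (hχ : ∀ r, χ (algebraMap _ _ r) = ((F₁.presheaf.stalkCongr (.of_eq hw)).inv ≫ υ.stalkMap w).hom r)
    (hloc : @IsLocalization.AtPrime _ _ (F₂.presheaf.stalk w) _ χ.toAlgebra 𝔔.asIdeal _)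
    (b : {l : Fin k // l ≠ jj} → F₁.presheaf.stalk x)
    (hfr : ∀ l : {l : Fin k // l ≠ jj}, blowupAlgebra.frac c jj l.1 - algebraMap _ _ (b l) ∈ 𝔔.asIdeal)
    (hbm : IsUnit (b ⟨m, hm⟩))
    (𝔔' : PrimeSpectrum (blowupAlgebra (Ideal.span (Set.range c)) (c m)))
    (χ' : blowupAlgebra (Ideal.span (Set.range c)) (c m) →+* F₂.presheaf.stalk w)
    (hχ' : ∀ r, χ' (algebraMap _ _ r) = ((F₁.presheaf.stalkCongr (.of_eq hw)).inv ≫ υ.stalkMap w).hom r)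
    (hloc' : @IsLocalization.AtPrime _ _ (F₂.presheaf.stalk w) _ χ'.toAlgebra 𝔔'.asIdeal _) (l : {l : Fin k // l ≠ m}) :
    blowupAlgebra.frac c m l.1 -
      algebraMap _ _ ((if h : l.1 = jj then (1 : F₁.presheaf.stalk x) else b ⟨l.1, h⟩) * ↑hbm.unit⁻¹) ∈ 𝔔'.asIdeal := by
  have hEjj := stalkIdeal_comap_eq_span_of_chartPresentation w hw c hcJ jj χ hχ
  obtain ⟨t, ht, hKt⟩ := hυ.isEffectiveCartier.exists_stalkIdeal_eq_span w
  rw [hEjj] at hKt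
  have hnzd := mem_nonZeroDivisors_of_span_singleton_eq hKt ht
  exact frac_sub_mem_of_chartChange c jj m hm _ hnzd 𝔔.asIdeal χ hχ
    (fun b' => mem_chartPrime_iff_apply_mem_maximalIdeal 𝔔 χ hloc b') 𝔔'.asIdeal χ' hχ'
    (fun b' => mem_chartPrime_iff_apply_mem_maximalIdeal 𝔔' χ' hloc' b') b hfr hbm l

end ChartChangeScheme

end Summit.ResolutionOfSingularities.ResolutionOfSingularities.Cruxes.EquisingularLiftNat.Sections

end
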